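import Summits.AtomisticToContinuum.Crystallization.Theorems.FrustratedLawDichotomyAperiodicGapRecordJunctionHost
import Summits.AtomisticToContinuum.Crystallization.Theorems.FrustratedLawDichotomyStrainedPatchHomEntryLeafHTUCentredRot
import HarnessLib

/-!
# FrustratedLawDichotomy · crux `AperiodicFrustratedLawGap` (stmt-AtomisticToContinuum-27623) — RECORD JUNCTION with the HTU E-consumer of record
# (decomp-a2c, prover hand 2, generation 33; structural share, sequel of `…AperiodicGapRecordJunctionHost`)

Critic row 1228: «the E-consumer of record for (H) hcp-half moves to the HTU family the moment …HTUCentredRot (HT4UQDCR(X) + homFloor_625 end-to-end) is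
accepted».  hand 1's `…HomEntryLeafHTUCentredRot.homFloor_625_of_entryTrees6RBKP_HT4UQDCRX` supplies `HomFloor (1/625)` from ONE fcc tree over
`entryLeafOK6RBKP muRec` and ONE hcp tree over the reduced-universe centred-rotated union verdict `entryLeafOKHT4UQDCRX muRec P Qf T`.  This DEF-FREE
module plugs that consumer into the instantiable GENERIC T-side form of `…RecordJunctionHost`:

* `aperiodicFrustratedLawGap_of_entryTreesHTU_of_pricedDescent` (+ periodic sibling 27624) — the GENERIC priced-descent form (`…RecordJunctionHost` §1:
  any priced charge `Φ` with slack column `X`, top, finite step table, terminal `SlackCert`, cover) — the instantiable SHAPE of which lens-5 g74's rim-fold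
  (`…StrainedPatchRimFold`, critic row 1239; R1‴) is the instance `(Φ, X) := (foldPrice R Φ, foldCol R X Q)`.

The R1‴ × HTU junction of record itself is lens-5 g74's `…AperiodicGapRecordJunctionFold` (critic row 1242); this module deliberately does NOT restate it.
One-line compositions of tree theorems; 0 sorry; no definitions; standard axioms.  `--supports stmt-AtomisticToContinuum-27623`.  [folklore instantiation]
-/

noncomputable section

namespace Summit.AtomisticToContinuum.Crystallization.Theorems.FrustratedLawDichotomyAperiodicGapRecordJunctionHTU

open Summit.AtomisticToContinuum.Crystallization.Theorems.ChargedEnergyGapNegative (eStar E3)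
open Summit.AtomisticToContinuum.Crystallization.Theorems.FrustratedLawDichotomyRangeCut
open Summit.AtomisticToContinuum.Crystallization.Theorems.FrustratedLawDichotomySchurCut
open Summit.AtomisticToContinuum.Crystallization.Theorems.FrustratedLawDichotomyMotifLemmas (GoodAtScale)
open Summit.AtomisticToContinuum.Crystallization.Theorems.FrustratedLawDichotomyExemptLocOpt (LocOptFails)
open Summit.AtomisticToContinuum.Crystallization.Theorems.FrustratedLawDichotomyExemptSplit (SchurElasticPricingX)
open Summit.AtomisticToContinuum.Crystallization.Theorems.FrustratedLawDichotomyExemptAbsorptionRecord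
open Summit.AtomisticToContinuum.Crystallization.Theorems.FrustratedLawDichotomyCollarCensus
open Summit.AtomisticToContinuum.Crystallization.Theorems.FrustratedLawDichotomyCollarCensusKappa
open Summit.AtomisticToContinuum.Crystallization.Theorems.FrustratedLawDichotomyStrainedPatchHomSplit
open Summit.AtomisticToContinuum.Crystallization.Theorems.FrustratedLawDichotomyStrainedPatchCleanCollar (TailPenalty AnnularDefectFloor DefectiveCollarFloor)
open Summit.AtomisticToContinuum.Crystallization.Theorems.FrustratedLawDichotomyStrainedPatchPhaseCut (AnnularPhaseFloor PolyTextureFloor)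
open Summit.AtomisticToContinuum.Crystallization.Theorems.FrustratedLawDichotomyStrainedPatchCoreTubeRecord (CoreCoreRelief)
open Summit.AtomisticToContinuum.Crystallization.Theorems.FrustratedLawDichotomyStrainedPatchHostCells (FamilyCover)
open Summit.AtomisticToContinuum.Crystallization.Theorems.FrustratedLawDichotomyStrainedPatchHomCertTree (CertTree treeOK)
open Summit.AtomisticToContinuum.Crystallization.Theorems.FrustratedLawDichotomyStrainedPatchHomEntryGram (rootC rootW)
open Summit.AtomisticToContinuum.Crystallization.Theorems.FrustratedLawDichotomyStrainedPatchHomEntryGramHcp (rootCH rootWH)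
open Summit.AtomisticToContinuum.Crystallization.Theorems.FrustratedLawDichotomyStrainedPatchHomEntryTable (muRec)
open Summit.AtomisticToContinuum.Crystallization.Theorems.FrustratedLawDichotomyStrainedPatchHomEntryTableP (entryLeafOK6RBKP)
open Summit.AtomisticToContinuum.Crystallization.Theorems.FrustratedLawDichotomyStrainedPatchHomEntryLeafHT (HTCert entryLeafOKHT4UQDCRX
  homFloor_625_of_entryTrees6RBKP_HT4UQDCRX)
open Summit.AtomisticToContinuum.Crystallization.Theorems.FrustratedLawDichotomyStrainedPatchQuantSlaving (ChartFam HessTab ForceTab SlackTab hessBlk0 force0)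
open Summit.AtomisticToContinuum.Crystallization.Theorems.FrustratedLawDichotomyStrainedPatchSVCharge (SlackCert)
open Summit.AtomisticToContinuum.Crystallization.Theorems.FrustratedLawDichotomyAperiodicGapRecordJunction
open Summit.AtomisticToContinuum.Crystallization.Theorems.FrustratedLawDichotomyStrainedPatchChargePrice (RowPrice PricedCharge PriceTop PriceStep)
open Summit.AtomisticToContinuum.Crystallization.Theorems.FrustratedLawDichotomyAperiodicGapRecordJunctionHost
  (strainedPatchRec_of_homFloor_625_of_pricedDescent)

/-- ★★★ **27623 FROM THE ENTRY TREES (hcp: HTU consumer of record `entryLeafOKHT4UQDCRX`) AND A PRICED DESCENT** — the INSTANTIABLE SHAPE of record: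
`UP ∧ 0 ≤ D_X ∧ Eopt-raw ∧ (∃ fcc tree) ∧ (∃ hcp HTU tree) ∧ TailPenalty ∧ CoreCoreRelief ∧ PricedCharge 𝓘 τ Φ X ∧ PriceTop ∧ PriceStep-table ∧ SlackCert ∧
FamilyCover ∧ AnnularPhaseFloor ∧ PolyTextureFloor ∧ AnnularDefectFloor ∧ DefectiveCollarFloor ∧ CC∪T₀ ∧ DD∪T₀ ⟹ crux` (any priced charge `Φ`, slack column `X`;
critic row 1230's rim-fold is a choice of `(Φ, X)`). [folklore instantiation] -/
theorem aperiodicFrustratedLawGap_of_entryTreesHTU_of_pricedDescent {𝓘 : ChartFam} {τ : ℝ} {Φ : RowPrice} {X : SlackTab} {εE CE DE DX : ℝ}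
    (k : ℕ → ℝ) (n : ℕ) (hτ : 0 ≤ τ)
    (hε0 : 0 < εE) (hε1 : εE ≤ 1 / 10000) (hU : PeriodicEnergyCeiling (-(7175 / 10000))) (hDX : 0 ≤ DX)
    (hE : SchurElasticPricingX (1 / 20) (1 / 8) w₄₅ ω₄ (3 / 400) (-(7175 / 10000)) (1 / 10000) CE DE DX (LocOptFails eStar εE (3 / 2) 1))
    (P : ((Fin 3 × Fin 3) ⊕ Fin 3 → ℤ) → ((Fin 3 × Fin 3) ⊕ Fin 3 → ℤ) → HTCert)
    (Qf : ((Fin 3 × Fin 3) ⊕ Fin 3 → ℤ) → ((Fin 3 × Fin 3) ⊕ Fin 3 → ℤ) → (Fin 4 → ℤ))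
    (T : ((Fin 3 × Fin 3) ⊕ Fin 3 → ℤ) → ((Fin 3 × Fin 3) ⊕ Fin 3 → ℤ) → CertTree ((Fin 3 × Fin 3) ⊕ Fin 3))
    (hFcc : ∃ t : CertTree (Fin 3 × Fin 3), treeOK (entryLeafOK6RBKP muRec) t rootC rootW = true)
    (hHcp : ∃ t : CertTree ((Fin 3 × Fin 3) ⊕ Fin 3), treeOK (entryLeafOKHT4UQDCRX muRec P Qf T) t rootCH rootWH = true)
    (hT : TailPenalty (24 / 5) (1 / 1000)) (hRl : CoreCoreRelief (63 / 10) (63 / 10) (24 / 5) (1 / 100) (3 / 5000))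
    (hS : PricedCharge 𝓘 τ Φ X) (h0 : PriceTop 𝓘 τ Φ (k 0 * sigmaOne))
    (hs : ∀ i : ℕ, i < n → PriceStep 𝓘 τ sigmaOne Φ hessBlk0 force0 X (k i) (k (i + 1) * sigmaOne))
    (hC : SlackCert 𝓘 τ (k n) sigmaOne hessBlk0 force0 X) (hFC : FamilyCover 𝓘 (24 / 5) (1 / 100) (1 / 8) τ)
    (hF : AnnularPhaseFloor (63 / 10) (24 / 5) (63 / 10) (1 / 1000)) (hP : PolyTextureFloor (63 / 10) (24 / 5) (1 / 1000))
    (hA : AnnularDefectFloor (24 / 5) (63 / 10)) (hD : DefectiveCollarFloor (24 / 5))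
    (h2 : CrowdedCoreMotifPricingCapK (1 / 1000) (9 / 5) (133 / 10) (3 / 2) (effPot w₄₅ ω₄ (3 / 400)) (-(7175 / 10000) + 3 / 400)
      (Collar (9 / 2) fun N y j => (∃ s : ℝ, 0 ≤ s ∧ s ≤ 3 / 2 ∧ NonEquilibriumCore (-(7175 / 10000)) 0 7 s (1 / 10000) N y j) ∨
        GoodAtScale (1 / 20) (3 / 2) y j))
    (h3 : DiluteDefectMotifPricingCapK (1 / 1000) (9 / 5) (133 / 10) (3 / 2) (effPot w₄₅ ω₄ (3 / 400)) (-(7175 / 10000) + 3 / 400)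
      (Collar (9 / 2) fun N y j => (∃ s : ℝ, 0 ≤ s ∧ s ≤ 3 / 2 ∧ NonEquilibriumCore (-(7175 / 10000)) 0 7 s (1 / 10000) N y j) ∨
        GoodAtScale (1 / 20) (3 / 2) y j)) :
    Summit.AtomisticToContinuum.Crystallization.Theses.FrustratedLawDichotomy.AperiodicFrustratedLawGap :=
  aperiodicFrustratedLawGap_of_strainedPatchRec hε0 hε1 hU hDX hE
    (strainedPatchRec_of_homFloor_625_of_pricedDescent k n hτ (homFloor_625_of_entryTrees6RBKP_HT4UQDCRX P Qf T hFcc hHcp) hT hRl hS h0 hs hC hFC hF hP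
      hA hD) h2 h3

/-- ★★ **Periodic sibling (27624)** of `aperiodicFrustratedLawGap_of_entryTreesHTU_of_pricedDescent`. [folklore instantiation] -/
theorem periodicFrustratedLawGap_of_entryTreesHTU_of_pricedDescent {𝓘 : ChartFam} {τ : ℝ} {Φ : RowPrice} {X : SlackTab} {εE CE DE DX : ℝ}
    (k : ℕ → ℝ) (n : ℕ) (hτ : 0 ≤ τ)
    (hε0 : 0 < εE) (hε1 : εE ≤ 1 / 10000) (hU : PeriodicEnergyCeiling (-(7175 / 10000))) (hDX : 0 ≤ DX)
    (hE : SchurElasticPricingX (1 / 20) (1 / 8) w₄₅ ω₄ (3 / 400) (-(7175 / 10000)) (1 / 10000) CE DE DX (LocOptFails eStar εE (3 / 2) 1))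
    (P : ((Fin 3 × Fin 3) ⊕ Fin 3 → ℤ) → ((Fin 3 × Fin 3) ⊕ Fin 3 → ℤ) → HTCert)
    (Qf : ((Fin 3 × Fin 3) ⊕ Fin 3 → ℤ) → ((Fin 3 × Fin 3) ⊕ Fin 3 → ℤ) → (Fin 4 → ℤ))
    (T : ((Fin 3 × Fin 3) ⊕ Fin 3 → ℤ) → ((Fin 3 × Fin 3) ⊕ Fin 3 → ℤ) → CertTree ((Fin 3 × Fin 3) ⊕ Fin 3))
    (hFcc : ∃ t : CertTree (Fin 3 × Fin 3), treeOK (entryLeafOK6RBKP muRec) t rootC rootW = true)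
    (hHcp : ∃ t : CertTree ((Fin 3 × Fin 3) ⊕ Fin 3), treeOK (entryLeafOKHT4UQDCRX muRec P Qf T) t rootCH rootWH = true)
    (hT : TailPenalty (24 / 5) (1 / 1000)) (hRl : CoreCoreRelief (63 / 10) (63 / 10) (24 / 5) (1 / 100) (3 / 5000))
    (hS : PricedCharge 𝓘 τ Φ X) (h0 : PriceTop 𝓘 τ Φ (k 0 * sigmaOne))
    (hs : ∀ i : ℕ, i < n → PriceStep 𝓘 τ sigmaOne Φ hessBlk0 force0 X (k i) (k (i + 1) * sigmaOne))
    (hC : SlackCert 𝓘 τ (k n) sigmaOne hessBlk0 force0 X) (hFC : FamilyCover 𝓘 (24 / 5) (1 / 100) (1 / 8) τ)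
    (hF : AnnularPhaseFloor (63 / 10) (24 / 5) (63 / 10) (1 / 1000)) (hP : PolyTextureFloor (63 / 10) (24 / 5) (1 / 1000))
    (hA : AnnularDefectFloor (24 / 5) (63 / 10)) (hD : DefectiveCollarFloor (24 / 5))
    (h2 : CrowdedCoreMotifPricingCapK (1 / 1000) (9 / 5) (133 / 10) (3 / 2) (effPot w₄₅ ω₄ (3 / 400)) (-(7175 / 10000) + 3 / 400)
      (Collar (9 / 2) fun N y j => (∃ s : ℝ, 0 ≤ s ∧ s ≤ 3 / 2 ∧ NonEquilibriumCore (-(7175 / 10000)) 0 7 s (1 / 10000) N y j) ∨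
        GoodAtScale (1 / 20) (3 / 2) y j))
    (h3 : DiluteDefectMotifPricingCapK (1 / 1000) (9 / 5) (133 / 10) (3 / 2) (effPot w₄₅ ω₄ (3 / 400)) (-(7175 / 10000) + 3 / 400)
      (Collar (9 / 2) fun N y j => (∃ s : ℝ, 0 ≤ s ∧ s ≤ 3 / 2 ∧ NonEquilibriumCore (-(7175 / 10000)) 0 7 s (1 / 10000) N y j) ∨
        GoodAtScale (1 / 20) (3 / 2) y j)) :
    Summit.AtomisticToContinuum.Crystallization.Theses.FrustratedLawDichotomy.PeriodicFrustratedLawGap :=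
  periodicFrustratedLawGap_of_strainedPatchRec hε0 hε1 hU hDX hE
    (strainedPatchRec_of_homFloor_625_of_pricedDescent k n hτ (homFloor_625_of_entryTrees6RBKP_HT4UQDCRX P Qf T hFcc hHcp) hT hRl hS h0 hs hC hFC hF hP
      hA hD) h2 h3

end Summit.AtomisticToContinuum.Crystallization.Theorems.FrustratedLawDichotomyAperiodicGapRecordJunctionHTU

end
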